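import Mathlib
import HarnessLib
import HarnessLib.Audit
import Summits.AtomisticToContinuum.Statement
import Literature.MathematicalPhysics.StatisticalMechanics.BarlowStacking
import Literature.Barriers.AtomisticToContinuum.LocalizedPotentialsExcludeLennardJones

/-!
Route: MieLadderVdwKissing

CLOSED (retired) 2026-08-15T13:44:46Z by operator:999:1257524 — reason: not-a-thesis: assembly does not conclude the sub-problem Statement — note: D-0027 §2.1 audit (human 2026-08-15: routes that do not decide the summit are removed): the assembly concludes `Literature.MathematicalPhysics.StatisticalMechanics.Crystallization`, not the sub-problem statement; a NEW conforming route may be opened from the same idea (generated `closes : … → _root_. The file is kept as the record of this route; refuted decls are indexed as negative knowledge (`ledger negatives`).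

# Route MieLadderVdwKissing — the Mie (n,6) ladder from its top rung — hard spheres with the full
van der Waals tail crystallize onto hcp via the vdW kissing inequality, then descend in the exponent
to n = 12

X (it suffices to show): THE UPPER MIE LADDER CRYSTALLIZES — for every n ≥ 12 the Mie (n,6)
potential V_n(r) = r⁻ⁿ/n − r⁻⁶/6 (minimum −(1/6 − 1/n) at r = 1; V_12 = lennardJones, tree `mieWith
(1/n) (1/6) n 6`) satisfies both Blanc–Lewin conjuncts in ℝ³, HasPeriodicGroundStateEnergy V_n 3 ∧
IsCrystallizing V_n 3; X → Crystallization is the specialisation n = 12 (Assembly, sorry-free in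
Sketch.lean). Realises card mie-ladder-vdw-kissing. The route climbs DOWN the ladder from n = ∞,
where V_∞ = hard core + full van der Waals tail (Sutherland 1893) and, by dilation-optimality,
E_n(N) = −((n−6)/(6n)) · max over UNIT PACKINGS y of S₆(y)·(S₆(y)/S_n(y))^{6/(n−6)} with S_p =
Σ_{i≠j} r_ij^{−p}: every Mie ground state IS a unit sphere packing after rescaling, and at n = ∞ the
functional is the pure van der Waals attraction S₆ over packings — a new extremal problem of packing
type, the "van der Waals kissing problem". Ranked cruxes: (2) VdwKissing, the two-shell inequality
Σ_{1≤|x|≤3/2} |x|⁻⁶ ≤ 51/4 over unit packings around a centre (equality at the fcc/hcp two-shell: 12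
at 1, 6 at √2); (3) VdwOneCentre, its all-shell pointwise form Σ|x|⁻⁶ ≤ L₆(hcp) = 14.45489 (the hcp
site is the pointwise optimum among Barlow sites; the packing-icosahedral centre has 13.43 within
radius 2 against hcp's 13.86); (4) SutherlandCrystallizes, the top rung in Blanc–Lewin positional
form (maximisers of S₆ over N-point packings converge locally to a periodic configuration); (5)
MieDescentLarge, ∃ n₀ ∀ n ≥ n₀ both conjuncts for V_n by regular (penalty-method) perturbation from
the jammed rung. Support: SutherlandBound (energetic rung, corollary of (3)),
SutherlandMaximisersExist (vacuity guard). The window n ∈ [12, n₀) is the declared bet and is NOT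
decomposed at open (see Kill criteria / Not decomposed yet).
Lean: `∀ n : ℕ, 12 ≤ n →
Literature.MathematicalPhysics.StatisticalMechanics.HasPeriodicGroundStateEnergy
(Literature.Barriers.AtomisticToContinuum.mieWith (1 / (n : ℝ)) (1 / 6) n 6) 3 ∧
Literature.MathematicalPhysics.StatisticalMechanics.IsCrystallizing
(Literature.Barriers.AtomisticToContinuum.mieWith (1 / (n : ℝ)) (1 / 6) n 6) 3`

## Assembly
Frame only (D-0019): X → Crystallization is the specialisation n = 12 together with `mieWith
(1/((12:ℕ):ℝ)) (1/6) 12 6 = lennardJones` (funext + simp; proved sorry-free as `assembly_holds` in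
the folder's Sketch.lean). The cruxes are the rungs ABOVE the window: VdwKissing → VdwOneCentre →
(SutherlandBound) → SutherlandCrystallizes → MieDescentLarge gives X for n ≥ n₀; closing [12, n₀) is
the bet, earned later as a glued split of the Target.

Rationale: WHY THIS LINE. Every proved crystallization theorem perturbs from a brittle model whose local
problem is a packing problem (HeitmannRadin1980, Theil2006, FlatleyTheil2015; BlancLewin2015 §2.3),
and Lennard-Jones lies outside all of their hypothesis classes because of its r⁻⁶ tail
(Literature.Barriers.AtomisticToContinuum.LocalizedPotentialsExcludeLennardJones). The Mie ladder
changes the perturbation parameter from the TAIL SIZE to the WALL SOFTNESS 1/n: its top rung keeps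
the whole dispersion tail — 17 % of the hcp binding sits beyond contact (L₆ = 14.455 vs 12) and the
tail alone selects hcp over fcc (14.45489 vs 14.45392, KiharaKoba1952, Stillinger2001) — yet is
brittle: contacts are active constraints with positive multipliers, so maximisers should be EXACT
Barlow fragments as for sticky spheres, and Hales's η = 0 technology applies verbatim (tree:
Hales2012_kissingTwelve, HalesDSP_layerPackings_holds, flyspeck_L12). The rung then reduces to ONE
new inequality of spherical-code type (VdwKissing / VdwOneCentre), attackable by weighted
multi-radius three-point SDP bounds (BachocVallentin2007, DelaatDeoliveirafilhoVallentin2014,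
Laat2016) plus interval arithmetic rather than by Flyspeck-scale case analysis. Imported areas:
discrete geometry of packings (Hales 2012, Tammes/MusinTarasov2012), semidefinite programming bounds
for spherical codes, penalty-method / KKT continuation from constrained optimisation (descent in
1/n). Prior routes (CrystalKissingRigidity, CrystalLocalRigidity) work at n = 12 directly and need
ROBUST (η > 0) kissing rigidity; this line needs only η = 0 at the rung and isolates the soft-core
difficulty in one named descent statement; the physics literature has the ladder only as lattice
sums over Barlow/cuboidal families (BurrowsCooperSchwerdtfeger2021, CooperEtAl2024, TrombachEtAl2018
for clusters), never as theorems over all packings.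

RANKED CRUXES. Ranks: 2 = most informative single bit (cheap to falsify numerically,
certificate-attackable; its failure re-routes every dispersion-tail line to averaged certificates).
All Lean terms elaborate (folder Sketch.lean, lean check rc 0).
#0 MieLadderCrystallizes (target) — X: for every n ≥ 12 the Mie (n,6) potential V_n = mieWith (1/n)
(1/6) n 6 satisfies HasPeriodicGroundStateEnergy V_n 3 ∧ IsCrystallizing V_n 3 (n = 12 is the summit
conjunct; the cruxes deliver n ≥ n₀; the window [12, n₀) is the bet, to be split off as a child once
MieDescentLarge closes with an explicit n₀). (why it might fail: Strictly stronger than the summit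
(n = 12 is Lennard-Jones; every n ≥ 12 included); the cruxes reach only n ≥ n₀, and a 13-shell at
the Tammes radius beats 12 contacts at one-centre level for (n,6) up to n = 18, so the window [12,
n₀) needs second-shell pricing not filed here.) [BlancLewin2015, CooperEtAl2024, MusinTarasov2012,
FlatleyTheil2015]
#2 VdwKissing (crux) — TWO-SHELL VAN DER WAALS KISSING INEQUALITY (card D1): for every finite X ⊂ ℝ³
with 1 ≤ |x| ≤ 3/2 for all x ∈ X and pairwise distances ≥ 1 (the centres, within 3/2, of
unit-diameter balls packed around a unit ball at 0), Σ_{x∈X} |x|⁻⁶ ≤ 51/4 = 12 + 6·(√2)⁻⁶ — the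
value of the fcc/hcp two-shell (12 at distance 1, 6 octahedral caps at √2; the next Barlow distance
is √(8/3) = 1.633 > 3/2). A weighted spherical-code problem in the thick shell [1, 3/2]: expected
certificate = three-point / multi-radius SDP (Bachoc–Vallentin, de Laat–Oliveira–Vallentin) with the
weight r⁻⁶, verified in interval arithmetic; equality and first-order stability cases (18-point
Barlow two-shells, via scaledPattern) are layer 2. [difficulty: L] (why it might fail: Untested
beyond hand checks: twelve kissing balls can leave holes deeper than the octahedral one (a 13th
centre at 2cos θ < √2 behind a hole of angular radius θ > 45°); two 50° holes (2×0.221) plus three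
squares (3×0.125) = 0.817 > 0.75 would already break 51/4 at cutoff 3/2.) [Hales2012,
BachocVallentin2007, DelaatDeoliveirafilhoVallentin2014, Laat2016, KusnerKusnerLagariasShlosman2018,
MusinTarasov2012, ConwaySloane1999]
#3 VdwOneCentre (crux) — ONE-CENTRE VAN DER WAALS THEOREM (all shells, pointwise; the route's
sharpening of card D2): for every finite X ⊂ ℝ³ with |x| ≥ 1 for x ∈ X and pairwise distances ≥ 1,
Σ_{x∈X} |x|⁻⁶ ≤ L₆(hcp) := Σ_{y ∈ hcp, y ≠ 0} |y|⁻⁶ = 14.45489… at nearest-neighbour distance 1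
(Lean: the tsum over `hcpStacking 1 √(2/3)`, whose y = 0 term is 0⁻¹ = 0). Evidence: among Barlow
environments the hcp SITE is the pointwise maximum (aligned-minus-staggered layer differences D_k >
0 decrease in k, so "aligned at every even layer distance" is optimal and that is the hcp site; fcc
14.45392); the packing-icosahedral centre (12 at 1, 20 face caps at 1.589, 12 at 2) reaches 13.43
within radius 2 against hcp's 13.86 (folder calc/ico_centre.py) — the card's "14.7 at a Mackay
centre" is a compressed LJ cluster, not a packing; bcc at unit separation 12.25. If true, NO
averaged / transfer tail argument is needed at the top rung: SutherlandBound follows by summing over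
centres. [deps: VdwKissing] [difficulty: L] (why it might fail: Pointwise may fail by < 3%: a
12-kissed centre with non-Barlow but favourable 2nd–4th shells (Bergman/Mackay-type packing
clusters, Z16-type sites at unit separation, Böröczky–Szabó quasi-12-neighbour packings) could
exceed 14.4549 while hcp still wins on average (then SutherlandBound is the crux).) [KiharaKoba1952,
Stillinger2001, BurrowsCooperSchwerdtfeger2021, CooperEtAl2024, BoroczkySzabo2016, ConwaySloane1999,
Hales2012]
#4 SutherlandCrystallizes (crux) — SUTHERLAND RUNG, POSITIONAL (Blanc–Lewin (16) at n = ∞; card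
D1+D3+D4): for every sequence x^N of MAXIMISERS of Σ_{i≠j} |x_i − x_j|⁻⁶ over N-point unit packings
of ℝ³ (hard core + full van der Waals tail — the Sutherland 1893 model, Γ-limit of V_n), there are a
subsequence, translations and a periodic configuration P (expected hcp, a = 1, c = √(8/3)) such that
Σ_i f(x_i + τ_j) → Σ_{s ∈ P.points} f(s) for every continuous compactly supported f (multiplicity 1:
packings are 1-separated). Mechanism: VdwKissing / VdwOneCentre with their equality cases make all
but O(N^{2/3}) sites carry EXACT Barlow two-shells (first-order loss for any broken contact, no
compensating gain); Hales's η = 0 classification (tree: Hales2012_kissingTwelve +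
HalesDSP_layerPackings_holds, LayerPropagation) turns them into Barlow fragments; the tail selects
hcp among Hägg words with a gap D₂ − D₃ > 0 per fault plane (cards
mirror-layers-reflection-positivity / monotone-pairing-stacking-lemma; HaggDominationAllRanges
pattern at a = 1, h = √(2/3), V = −r⁻⁶), so ≤ K faults; pigeonhole windows +
`tendsto_sum_of_eventually_near'`. [deps: VdwKissing, VdwOneCentre] [difficulty: XL] (why it might
fail: Fails if maximisers carry unboundedly many stacking faults (Hägg domination for pure r⁻⁶ at
contact, D₂ ≈ 4e-4 vs Σ_{k≥3} D_k, is uncertified), if equality in VdwKissing is not first-order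
rigid (flexible near-Barlow two-shells), or if boundary effects keep exact maximisers non-Barlow in
the bulk.) [Sutherland1893, BlancLewin2015, Hales2012, HalesDSP2012, HeitmannRadin1980,
CooperEtAl2024, Stillinger2001, RadinSchulman1983]
#5 MieDescentLarge (crux) — DESCENT IN THE EXPONENT (card D5): there is n₀ such that for every n ≥
n₀ the Mie (n,6) potential V_n = mieWith (1/n) (1/6) n 6 satisfies HasPeriodicGroundStateEnergy V_n
3 ∧ IsCrystallizing V_n 3 — the first three-dimensional crystallization theorem for a pure pair
potential carrying the non-localised van der Waals tail (outside Theil's and Flatley–Theil's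
classes). Mechanism: by dilation-optimality E_n(N) = −((n−6)/(6n)) · max over unit packings y of
S₆(y)·(S₆(y)/S_n(y))^{6/(n−6)}, so V_n ground states ARE unit packings after rescaling and the
correction factor tends to 1 as n → ∞ uniformly in N (S₆, S_n extensive); first-order (linear)
stability of the jammed rung — active contacts with strictly positive multipliers, strict
complementarity — absorbs the wall softness as in the exact-penalty / KKT continuation of
constrained optimisation; stacking selection is uniform in n (domination ratios grow with n). [deps:
VdwKissing, VdwOneCentre, SutherlandCrystallizes] [difficulty: XL] (why it might fail: Regular
perturbation needs LINEAR stability of the rung with constants and uniform-in-N control of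
near-contacts; the soft wall binds compressed 13-shells until n ≈ 57 (V_n(0.9565) < 0) and stretched
ones win one-centre accounting until n = 18, so n₀ is large and second shells may reorganise.)
[FlatleyTheil2015, Theil2006, TrombachEtAl2018, CooperEtAl2024, BlancLewin2015, MusinTarasov2012,
Literature.Barriers.AtomisticToContinuum.LocalizedPotentialsExcludeLennardJones]
#9 SutherlandBound (support) — SUTHERLAND RUNG, ENERGETIC ("hcp maximises the van der Waals
attraction among all sphere packings"): for every N and every N-point unit packing x of ℝ³, Σ_i
Σ_{j≠i} |x_i − x_j|⁻⁶ ≤ N · L₆(hcp) (diagonal terms are 0⁻¹ = 0 in Lean). Corollary of VdwOneCentre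
by summing over centres (filed because it is the energetic top-rung statement other dispersion-tail
cards want — theta-universality-packings at its r⁻⁶ slice, adhesive-spheres-weak-cm-tail — and
because it becomes THE crux, to be proved by the two-shell deficit of VdwKissing plus an averaged
tail transfer (card D2), if the pointwise VdwOneCentre dies). With the hcp ball as trial packing it
gives sup_N (1/N)·max S₆ = L₆(hcp) and, via hcpPeriodicConfiguration, the periodic maximum is
attained. [difficulty: M] [VdwOneCentre, KiharaKoba1952, Stillinger2001, CooperEtAl2024]
#9 SutherlandMaximisersExist (support) — VACUITY GUARD for SutherlandCrystallizes: for every N there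
is an N-point unit packing maximising Σ_i Σ_{j≠i} |x_i − x_j|⁻⁶ among N-point unit packings
(translation-normalise; a maximising sequence may be taken 2N-bounded since separating a far
component never increases a sum of positive decreasing weights and re-approaching it along the axis
of separation until first contact increases every cross term; compactness + continuity of r ↦ r⁻⁶ on
[1, ∞)). [difficulty: provable-now] [BlancLewin2015, LennardJonesGroundStatesExist_holds]

TWO-LAYER PLAN. Foreseen glued splits (k ≤ 3, depth 1), none filed now: MieLadderCrystallizes ⇐
MieAboveN0 (= MieDescentLarge with its explicit n₀) → MieWindow (12 ≤ n < n₀, second-shell price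
list: cards link-census-gauss-bonnet-3d / margin-map-one-centre-traps) → MieLadderCrystallizes.
SutherlandCrystallizes ⇐ ExactTwoShellsOffDefects (equality + first-order rigidity of VdwKissing ⇒
all but O(N^{2/3}) sites have exact Barlow two-shells) → HcpSelectionAtContact (Hägg domination for
V = −r⁻⁶, a = 1, h = √(2/3), certified D_k) → SutherlandCrystallizes (glue: LayerPropagation +
pigeonhole windows + tendsto_sum_of_eventually_near'). MieDescentLarge ⇐ RungLinearStability
(deficit ≥ c·Σ_i min(η_i, η₀), η_i = matching distance of the two-shell of site i to a Barlow
two-shell) → SoftWallReduction (V_n ground states rescaled to unit packings lose ≤ C·N·log n/n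
against S₆, uniformly in N) → MieDescentLarge.

KILL CRITERIA. VdwKissing refuted by an explicit configuration at cutoff 3/2 ⇒ restate with cutoff
√2 (Σ_{|x|≤√2} ≤ 51/4) or a smooth cutoff vanishing before √(8/3); refuted even at √2 ⇒ pointwise
two-shell certificates are dead for r⁻⁶: close this route `superseded` by the averaged-certificate
lines (theta-universality-packings / frustration-range-lp-hierarchy), keeping SutherlandBound as a
shared item. VdwOneCentre refuted (a packing centre with Σ|x|⁻⁶ > 14.4549) ⇒ restate crux 3 as
SutherlandBound (averaged). SutherlandBound refuted (a periodic non-Barlow unit packing with larger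
r⁻⁶ energy per particle than hcp) ⇒ the Sutherland rung does not crystallize onto hcp: close
`refuted:SutherlandBound` — and that is news for every dispersion-tail card of the sub.
SutherlandCrystallizes refuted through unbounded stacking disorder ⇒ pivot to the energetic ladder
only (HasPeriodicGroundStateEnergy halves), restating cruxes 4–5. A certified competitor beating
relaxed hcp for Φ_n = S₆(S₆/S_n)^{6/(n−6)} at some n > 12 (a phase transition ON the ladder above
Lennard-Jones) refutes the Target: close `refuted:MieLadderCrystallizes` (the rung theorems survive
as Literature targets; Lennard-Jones itself is untouched). Crystallization proved by another route
moots only the Target/Assembly frame.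

NOT DECOMPOSED YET. Equality and first-order-stability cases of VdwKissing (need the 18-point
patterns fccTwoShell = scaledPattern (fccInt ∪ {±2eᵢ}) 2 and hcpTwoShell = scaledPattern (hcpInt ∪
{(6,0,0),(0,6,0),(0,0,6),(2,−4,−4),(−4,2,−4),(−4,−4,2)}) 18 — a definition request once crux 2
moves); the cutoff radius as a parameter (√2 ≤ R < √(8/3)); certified layer differences D_k for V =
−r⁻⁶ at contact and the Hägg-domination inequality (shared in substance with items 0716/0737 but at
a = 1, h = √(2/3), no relaxation — simpler); quantitative (linear) stability of the rung and the
soft-wall reduction (children of MieDescentLarge); the value of n₀; the window [12, n₀)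
(second-shell pricing; cards link-census-gauss-bonnet-3d, margin-map-one-centre-traps,
three-cone-certificate); existence of Mie (n,6) ground states for every N (vacuity guard for
IsCrystallizing (mieWith …), the Blanc–Lewin §1.2 argument exactly as in
LennardJonesGroundStatesExist_holds); which periodic P (hcp up to rigid motion) in
SutherlandCrystallizes. All wait for crux 2 or 3 to move.

CHEAPEST FALSIFIER. (1) Numerical global maximisation of Σ_{|x|≤3/2} |x|⁻⁶ over ≤ 24 unit-separated
movable points with |x| ≥ 1 around a fixed centre (multistart projected gradient / basin hopping,
minutes of kit time): any value > 12.75 kills VdwKissing at 3/2 (then rerun at √2). (2) The same for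
the full sum with ≤ 90 points inside radius 2.3 against hcp's partial sums (13.859 at R = 2, 14.233
at R = 3) plus hcp's remainder: kills VdwOneCentre. (3) A lattice-sum scan of L₆ at unit minimal
distance over A15, σ, C14/C15, β-Mn, the bcc–fcc Bain path, tet-oct tilings, Böröczky–Szabó-type
quasi-12-neighbour packings: any value > 14.4549 kills SutherlandBound and the rung. What I could
run without kit (folder calc/, plain python) is in NUMBERS: nothing found above 12.75; the
widened-square competitor loses at first order.

NUMBERS. L₆(hcp) = 14.45489, L₆(fcc) = 14.45392, L₁₂(hcp) = 12.13229, L₁₂(fcc) = 12.13188 at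
nearest-neighbour distance 1 (own sums, calc/lattice_sums.py; Stillinger2001; KiharaKoba1952); hcp
shells (r, count): (1,12), (√2,6), (√(8/3),2), (√3,18), (√(11/3),12), (2,6); fcc: (1,12), (√2,6),
(√3,24), (2,12). Two-shell value 51/4; weights r⁻⁶: 1.05 → 0.746, 1.1 → 0.564, 1.2 → 0.335, 1.2856
(13th ball behind a 50° hole) → 0.221, √2 → 0.125, 3/2 → 0.0878, 1.589 (icosahedral face cap) →
0.062. Packing-icosahedral centre (12 at 1, 20 face caps at 1.589, 12 at 2): 13.43 within R = 2
against hcp 13.86 (calc/ico_centre.py); bcc 12.25. WIDENED-SQUARE COMPETITOR (refuter-12 second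
opinion on the card, 2026-08-15T10:51Z, from the Hopkins–Stillinger–Torquato arXiv:1009.3003
neighbour-count data): widening one square hollow of the cuboctahedral shell to side 1 + δ brings
its cap in to 2cos(45°+δ) ≈ √2(1 − δ), gain +0.75δ in r⁻⁶ weight, but each of the FOUR adjacent
square hollows receives one pushed vertex moving straight at its own centre, so its cap recedes to
at least 2 sin(45°+δ) ≈ √2(1 + δ) whatever its other three vertices do, loss 0.75δ each: net −2.25δ
at first order — the Barlow two-shell is first-order strictly optimal against this move
(calc/widen.py: forcing side 1.02 already pushes every other cap beyond 1.46, S_{3/2} = 12.56).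
Crude multistart projected-gradient search (calc/vdw2.py; 5 seeds × ~25 starts; M = 13–22 free
points: perturbed cuboctahedral two-shells, cuboctahedral + extra points, icosahedral shell +
extras, random shells; cutoffs 3/2 and √2): maximum 12.75, attained only by the Barlow two-shell
itself; next best 12.69 (cuboctahedral + intruders), icosahedral family ≤ 12.37, random ≤ 12.37 —
weak evidence (poor optimiser, no certificate), recorded so refuters start from it. Tammes-13 radius
1.04557 for unit chords (MusinTarasov2012): on the (n,6) ladder a stretched 13-shell
(13·V_n(1.0456)) beats 12 contacts (12·V_n(1)) at one-centre level iff n ≤ 18 (n = 12: −1.0237 vs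
−1.0000; n = 19: −1.3649 vs −1.3684), and the compressed variant (shell–shell 0.9565) still binds,
V_n(0.9565) < 0, until n ≈ 57. LJ-hcp energy per particle −L₆²/(24·L₁₂) = −0.7176 = −8.611/12
(scale-free quotient; fcc −8.610/12). Items at open: 8 (target, 4 cruxes, 2 support, assembly).

DEFINITION REQUESTS. None at open: hcpStacking / hcpPeriodicConfiguration (BarlowStacking.lean),
mieWith (LocalizedPotentialsExcludeLennardJones.lean), PeriodicConfiguration /
HasPeriodicGroundStateEnergy / IsCrystallizing (Crystallization.lean), scaledPattern / fccInt /
hcpInt (KissingPatterns.lean) exist. Foreseen (layer 2): `fccTwoShell`, `hcpTwoShell : Finset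
(EuclideanSpace ℝ (Fin 3))` (18-point Barlow two-shells, topic Literature/Geometry/DiscreteGeometry)
for the equality case of VdwKissing; a cite fact for the Tammes N = 13 value (MusinTarasov2012) if
the window work starts.

Novelty: Searches (2026-08-15): `lit frontier AtomisticToContinuum --since 2020` (30 rows; crystallization
descendants: arXiv:2407.20762, arXiv:2604.19239, arXiv:2603.00011 — none on hard-core + tail or Mie
ladders); `lit bridges AtomisticToContinuum --cross any` (nothing on packings/crystals); `lit search
--source crossref "Mie potential crystal structure stability hcp fcc repulsive exponent"` (11, noise
+ Kratky 1981 hard-sphere fcc/hcp); `lit search --source crossref "Schwerdtfeger Lennard-Jones hcp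
fcc lattice"` (15: doi:10.1103/physreve.104.035306, doi:10.1021/acs.jpclett.4c01986, van de Waal
1991 PRL 67:3263); `lit read arXiv:2107.11380` (held, grepped: SHS model with r⁻ⁿ attractive term,
lattice sums along the bcc–fcc path; "two-body forces favor dense packings with the largest kissing
number", p. 4); `lit read doi:10.1021/acs.jpclett.4c01986` (paywalled, acq-00019 cite-only); `lit
search --hybrid` local (0 relevant); `lit galaxy search "sticky hard sphere" --star all` (24 rows,
colloid/soft-matter noise); openalex/arxiv/zbmath rate-limited today; the card's and two
neighbouring cards' audited searches (crossref "hard sphere attractive tail ground state hcp proof"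
0; "Mie potential crystallization three dimensions" 0).
Nearest prior art found: BurrowsCooperSchwerdtfeger2021 (arXiv:2107.11380) and CooperEtAl2024
(doi:10.1021/acs.jpclett.4c01986) — the Schwerdtfeger school's "sticky hard sphere + r⁻ⁿ tail" model
and the hard-to-soft (n,m) Lennard-Jones ladder evaluated by EXACT L  [refs: 10.1103/physreve.104.035306, 10.1021/acs.jpclett.4c01986, 10.1021/acs.jpclett.4c01986`, 10.1007/s00220-008-0586-2, 2407.20762, 2604.19239, 2603.00011, 2107.11380, doi:10.1103/physreve.104.035306, doi:10.1021/acs.jpclett.4c01986, doi:10.1007/s00220-008-0586-2, BurrowsCooperSchwerdtfeger2021, CooperEtAl2024, TrombachEtAl2018, KiharaKoba1952, Stillinger2001, Hales2012, HalesDSP2012, BachocVallentin20]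

Barriers (technique_class: exponent-continuation vdw-packing sphere-packing-reduction): - technique_class: exponent-continuation vdw-packing sphere-packing-reduction
- Literature.Barriers.AtomisticToContinuum.LocalizedPotentialsExcludeLennardJones: APPLIES in spirit
(perturbation from a brittle model) and is embraced: no Theil/Flatley–Theil theorem is instantiated;
the base model carries the FULL r⁻⁶ tail and the small parameter is the wall softness 1/n, not the
tail size; Lennard-Jones is reached only if the window [12, n₀) closes — the declared bet (Target's
why-might-fail).
- Literature.Barriers.AtomisticToContinuum.KissingTwelveDegeneracy: APPLIES to every contact-count
argument (twelve contacts never select the walk); evaded because the functional is not the contact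
count but Σ r⁻⁶ over ALL shells: the hcp site is the strict pointwise optimum among Barlow sites (D₂
− D₃ + D₄ − … > 0) and SutherlandCrystallizes selects through the tail beyond √(8/3) (its evasion
(ii)).
- Literature.Barriers.AtomisticToContinuum.ShortRangeStackingBlindness: respected, not met: nothing
below √(8/3) is asked to select a stacking — VdwKissing (cutoff 3/2) is deliberately stacking-blind
(fcc and hcp two-shells tie at 51/4); selection lives in VdwOneCentre / SutherlandCrystallizes
through the untruncated tail.
- Literature.Barriers.AtomisticToContinuum.FlexibleKissingArrangements: APPLIES to single-shell
COUNT inference; evaded twice: the r⁻⁶ weight prices the second shell (octahedral caps at √2 reward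
square holes, the contact-free icosahedral shell scores only 12 < 51/4), and ri

History (route lifecycle, newest last):
- 2026-08-15T13:44:47Z · CLOSED retired — not-a-thesis: assembly does not conclude the sub-problem Statement (operator:999:1257524)

sub-problem: Crystallization · status: closed(retired) · opened planner-plancard-AtomisticToContinuum-Crystal-82f0e224-0 2026-08-15T11:14:40Z · rev 1 · ledger route-AtomisticToContinuum-MieLadderVdwKissing
GENERATED by the gate from the ledger (D-0016/17). Provers cite these decls: `theorem foo : Summit.AtomisticToContinuum.Crystallization.Theses.MieLadderVdwKissing.<Decl> := …` in Summits/AtomisticToContinuum/Crystallization/Theorems/<Name>.lean.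
-/

namespace Summit.AtomisticToContinuum.Crystallization.Theses.MieLadderVdwKissing

open scoped BigOperators Topology Manifold Classical MeasureTheory ProbabilityTheory Matrix InnerProductSpace ComplexConjugate ContinuousMap
open Filter Set Function TopologicalSpace MeasureTheory

attribute [summit_statement] _root_.Crystallization

/-- item stmt-AtomisticToContinuum-3263 · target · rank 0 · closed · moot by None · by planner
why it might fail: Strictly stronger than the summit (n = 12 is Lennard-Jones; every n ≥ 12 included); the cruxes reach only n ≥ n₀, and a 13-shell at the Tammes radius beats 12 contacts at one-centre level for (n,6) up to n = 18, so the window [12, n₀) needs second-shell pricing not filed here.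
sources: BlancLewin2015, CooperEtAl2024, MusinTarasov2012, FlatleyTheil2015
[target] X: for every n ≥ 12 the Mie (n,6) potential V_n = mieWith (1/n) (1/6) n 6 satisfies
HasPeriodicGroundStateEnergy V_n 3 ∧ IsCrystallizing V_n 3 (n = 12 is the summit conjunct; the
cruxes deliver n ≥ n₀; the window [12, n₀) is the bet, to be split off as a child once
MieDescentLarge closes with an explicit n₀). -/
@[route_item "route-AtomisticToContinuum-MieLadderVdwKissing"]
def MieLadderCrystallizes : Prop :=
  ∀ n : ℕ, 12 ≤ n → Literature.MathematicalPhysics.StatisticalMechanics.HasPeriodicGroundStateEnergy (Literature.Barriers.AtomisticToContinuum.mieWith (1 / (n : ℝ)) (1 / 6) n 6) 3 ∧ Literature.MathematicalPhysics.StatisticalMechanics.IsCrystallizing (Literature.Barriers.AtomisticToContinuum.mieWith (1 / (n : ℝ)) (1 / 6) n 6) 3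

/-- item stmt-AtomisticToContinuum-3264 · crux · rank 2 · closed · moot by None · by planner
why it might fail: Untested beyond hand checks: twelve kissing balls can leave holes deeper than the octahedral one (a 13th centre at 2cos θ < √2 behind a hole of angular radius θ > 45°); two 50° holes (2×0.221) plus three squares (3×0.125) = 0.817 > 0.75 would already break 51/4 at cutoff 3/2.
sources: Hales2012, BachocVallentin2007, DelaatDeoliveirafilhoVallentin2014, Laat2016, KusnerKusnerLagariasShlosman2018, MusinTarasov2012
[crux] TWO-SHELL VAN DER WAALS KISSING INEQUALITY (card D1): for every finite X ⊂ ℝ³ with 1 ≤ |x| ≤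
3/2 for all x ∈ X and pairwise distances ≥ 1 (the centres, within 3/2, of unit-diameter balls packed
around a unit ball at 0), Σ_{x∈X} |x|⁻⁶ ≤ 51/4 = 12 + 6·(√2)⁻⁶ — the value of the fcc/hcp two-shell
(12 at distance 1, 6 octahedral caps at √2; the next Barlow distance is √(8/3) = 1.633 > 3/2). A
weighted spherical-code problem in the thick shell [1, 3/2]: expected certificate = three-point /
multi-radius SDP (Bachoc–Vallentin, de Laat–Oliveira–Vallentin) with the weight r⁻⁶, verified in
interval arithmetic; equality and first-order stability cases (18-point Barlow two-shells, via
scaledPattern) are layer 2. [difficulty: L] -/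
@[route_item "route-AtomisticToContinuum-MieLadderVdwKissing"]
def VdwKissing : Prop :=
  ∀ X : Finset (EuclideanSpace ℝ (Fin 3)), (∀ x ∈ X, 1 ≤ ‖x‖ ∧ ‖x‖ ≤ 3 / 2) → (∀ x ∈ X, ∀ y ∈ X, x ≠ y → 1 ≤ dist x y) → ∑ x ∈ X, ‖x‖⁻¹ ^ 6 ≤ 51 / 4

/-- item stmt-AtomisticToContinuum-3265 · crux · rank 3 · closed · moot by None · by planner
why it might fail: Pointwise may fail by < 3%: a 12-kissed centre with non-Barlow but favourable 2nd–4th shells (Bergman/Mackay-type packing clusters, Z16-type sites at unit separation, Böröczky–Szabó quasi-12-neighbour packings) could exceed 14.4549 while hcp still wins on average (then SutherlandBound is the crux).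
sources: KiharaKoba1952, Stillinger2001, BurrowsCooperSchwerdtfeger2021, CooperEtAl2024, BoroczkySzabo2016, ConwaySloane1999
[crux] ONE-CENTRE VAN DER WAALS THEOREM (all shells, pointwise; the route's sharpening of card D2):
for every finite X ⊂ ℝ³ with |x| ≥ 1 for x ∈ X and pairwise distances ≥ 1, Σ_{x∈X} |x|⁻⁶ ≤ L₆(hcp)
:= Σ_{y ∈ hcp, y ≠ 0} |y|⁻⁶ = 14.45489… at nearest-neighbour distance 1 (Lean: the tsum over
`hcpStacking 1 √(2/3)`, whose y = 0 term is 0⁻¹ = 0). Evidence: among Barlow environments the hcp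
SITE is the pointwise maximum (aligned-minus-staggered layer differences D_k > 0 decrease in k, so
"aligned at every even layer distance" is optimal and that is the hcp site; fcc 14.45392); the
packing-icosahedral centre (12 at 1, 20 face caps at 1.589, 12 at 2) reaches 13.43 within radius 2
against hcp's 13.86 (folder calc/ico_centre.py) — the card's "14.7 at a Mackay centre" is a
compressed LJ cluster, not a packing; bcc at unit separation 12.25. If true, NO averaged / transfer
tail argument is needed at the top rung: SutherlandBound follows by summing over centres. [deps:
VdwKissing] [difficulty: L] -/
@[route_item "route-AtomisticToContinuum-MieLadderVdwKissing"]
def VdwOneCentre : Prop :=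
  ∀ X : Finset (EuclideanSpace ℝ (Fin 3)), (∀ x ∈ X, 1 ≤ ‖x‖) → (∀ x ∈ X, ∀ y ∈ X, x ≠ y → 1 ≤ dist x y) → ∑ x ∈ X, ‖x‖⁻¹ ^ 6 ≤ ∑' y : ↥(Literature.MathematicalPhysics.StatisticalMechanics.hcpStacking 1 (Real.sqrt (2 / 3))), ‖(y : EuclideanSpace ℝ (Fin 3))‖⁻¹ ^ 6

/-- item stmt-AtomisticToContinuum-3266 · crux · rank 4 · closed · moot by None · by planner
why it might fail: Fails if maximisers carry unboundedly many stacking faults (Hägg domination for pure r⁻⁶ at contact, D₂ ≈ 4e-4 vs Σ_{k≥3} D_k, is uncertified), if equality in VdwKissing is not first-order rigid (flexible near-Barlow two-shells), or if boundary effects keep exact maximisers non-Barlow in the bulk.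
sources: Sutherland1893, BlancLewin2015, Hales2012, HalesDSP2012, HeitmannRadin1980, CooperEtAl2024
[crux] SUTHERLAND RUNG, POSITIONAL (Blanc–Lewin (16) at n = ∞; card D1+D3+D4): for every sequence
x^N of MAXIMISERS of Σ_{i≠j} |x_i − x_j|⁻⁶ over N-point unit packings of ℝ³ (hard core + full van
der Waals tail — the Sutherland 1893 model, Γ-limit of V_n), there are a subsequence, translations
and a periodic configuration P (expected hcp, a = 1, c = √(8/3)) such that Σ_i f(x_i + τ_j) → Σ_{s ∈
P.points} f(s) for every continuous compactly supported f (multiplicity 1: packings are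
1-separated). Mechanism: VdwKissing / VdwOneCentre with their equality cases make all but O(N^{2/3})
sites carry EXACT Barlow two-shells (first-order loss for any broken contact, no compensating gain);
Hales's η = 0 classification (tree: Hales2012_kissingTwelve + HalesDSP_layerPackings_holds,
LayerPropagation) turns them into Barlow fragments; the tail selects hcp among Hägg words with a gap
D₂ − D₃ > 0 per fault plane (cards mirror-layers-reflection-positivity /
monotone-pairing-stacking-lemma; HaggDominationAllRanges pattern at a = 1, h = √(2/3), V = −r⁻⁶), so
≤ K faults; pigeonhole windows + `tendsto_sum_of_eventually_near'`. [deps: VdwKissing, VdwOneCentre]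
[difficulty: XL] -/
@[route_item "route-AtomisticToContinuum-MieLadderVdwKissing"]
def SutherlandCrystallizes : Prop :=
  ∀ x : (N : ℕ) → (Fin N → EuclideanSpace ℝ (Fin 3)), (∀ N, (∀ i j, i ≠ j → 1 ≤ dist (x N i) (x N j)) ∧ ∀ y : Fin N → EuclideanSpace ℝ (Fin 3), (∀ i j, i ≠ j → 1 ≤ dist (y i) (y j)) → ∑ i, ∑ j, (dist (y i) (y j))⁻¹ ^ 6 ≤ ∑ i, ∑ j, (dist (x N i) (x N j))⁻¹ ^ 6) → ∃ (φ : ℕ → ℕ) (τ : ℕ → EuclideanSpace ℝ (Fin 3)) (P : Literature.MathematicalPhysics.StatisticalMechanics.PeriodicConfiguration 3), StrictMono φ ∧ ∀ f : EuclideanSpace ℝ (Fin 3) → ℝ, Continuous f → HasCompactSupport f → Filter.Tendsto (fun j => ∑ i : Fin (φ j), f (x (φ j) i + τ j)) Filter.atTop (nhds (∑' s : ↥P.points, f (s : EuclideanSpace ℝ (Fin 3))))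

/-- item stmt-AtomisticToContinuum-3267 · crux · rank 5 · closed · moot by None · by planner
why it might fail: Regular perturbation needs LINEAR stability of the rung with constants and uniform-in-N control of near-contacts; the soft wall binds compressed 13-shells until n ≈ 57 (V_n(0.9565) < 0) and stretched ones win one-centre accounting until n = 18, so n₀ is large and second shells may reorganise.
sources: FlatleyTheil2015, Theil2006, TrombachEtAl2018, CooperEtAl2024, BlancLewin2015, MusinTarasov2012
[crux] DESCENT IN THE EXPONENT (card D5): there is n₀ such that for every n ≥ n₀ the Mie (n,6)
potential V_n = mieWith (1/n) (1/6) n 6 satisfies HasPeriodicGroundStateEnergy V_n 3 ∧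
IsCrystallizing V_n 3 — the first three-dimensional crystallization theorem for a pure pair
potential carrying the non-localised van der Waals tail (outside Theil's and Flatley–Theil's
classes). Mechanism: by dilation-optimality E_n(N) = −((n−6)/(6n)) · max over unit packings y of
S₆(y)·(S₆(y)/S_n(y))^{6/(n−6)}, so V_n ground states ARE unit packings after rescaling and the
correction factor tends to 1 as n → ∞ uniformly in N (S₆, S_n extensive); first-order (linear)
stability of the jammed rung — active contacts with strictly positive multipliers, strict
complementarity — absorbs the wall softness as in the exact-penalty / KKT continuation of
constrained optimisation; stacking selection is uniform in n (domination ratios grow with n). [deps: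
VdwKissing, VdwOneCentre, SutherlandCrystallizes] [difficulty: XL] -/
@[route_item "route-AtomisticToContinuum-MieLadderVdwKissing"]
def MieDescentLarge : Prop :=
  ∃ n₀ : ℕ, ∀ n : ℕ, n₀ ≤ n → Literature.MathematicalPhysics.StatisticalMechanics.HasPeriodicGroundStateEnergy (Literature.Barriers.AtomisticToContinuum.mieWith (1 / (n : ℝ)) (1 / 6) n 6) 3 ∧ Literature.MathematicalPhysics.StatisticalMechanics.IsCrystallizing (Literature.Barriers.AtomisticToContinuum.mieWith (1 / (n : ℝ)) (1 / 6) n 6) 3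

/-- item stmt-AtomisticToContinuum-3268 · support · rank 9 · open · by planner
sources: VdwOneCentre, KiharaKoba1952, Stillinger2001, CooperEtAl2024
[support] SUTHERLAND RUNG, ENERGETIC ("hcp maximises the van der Waals attraction among all sphere
packings"): for every N and every N-point unit packing x of ℝ³, Σ_i Σ_{j≠i} |x_i − x_j|⁻⁶ ≤ N ·
L₆(hcp) (diagonal terms are 0⁻¹ = 0 in Lean). Corollary of VdwOneCentre by summing over centres
(filed because it is the energetic top-rung statement other dispersion-tail cards want —
theta-universality-packings at its r⁻⁶ slice, adhesive-spheres-weak-cm-tail — and because it becomes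
THE crux, to be proved by the two-shell deficit of VdwKissing plus an averaged tail transfer (card
D2), if the pointwise VdwOneCentre dies). With the hcp ball as trial packing it gives sup_N
(1/N)·max S₆ = L₆(hcp) and, via hcpPeriodicConfiguration, the periodic maximum is attained.
[difficulty: M] -/
@[route_item "route-AtomisticToContinuum-MieLadderVdwKissing"]
def SutherlandBound : Prop :=
  ∀ (N : ℕ) (x : Fin N → EuclideanSpace ℝ (Fin 3)), (∀ i j, i ≠ j → 1 ≤ dist (x i) (x j)) → ∑ i, ∑ j, (dist (x i) (x j))⁻¹ ^ 6 ≤ (N : ℝ) * ∑' y : ↥(Literature.MathematicalPhysics.StatisticalMechanics.hcpStacking 1 (Real.sqrt (2 / 3))), ‖(y : EuclideanSpace ℝ (Fin 3))‖⁻¹ ^ 6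

/-- item stmt-AtomisticToContinuum-3269 · support · rank 9 · closed · moot by None · by planner
sources: BlancLewin2015, LennardJonesGroundStatesExist_holds
[support] VACUITY GUARD for SutherlandCrystallizes: for every N there is an N-point unit packing
maximising Σ_i Σ_{j≠i} |x_i − x_j|⁻⁶ among N-point unit packings (translation-normalise; a
maximising sequence may be taken 2N-bounded since separating a far component never increases a sum
of positive decreasing weights and re-approaching it along the axis of separation until first
contact increases every cross term; compactness + continuity of r ↦ r⁻⁶ on [1, ∞)). [difficulty:
provable-now] -/
@[route_item "route-AtomisticToContinuum-MieLadderVdwKissing"]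
def SutherlandMaximisersExist : Prop :=
  ∀ N : ℕ, ∃ x : Fin N → EuclideanSpace ℝ (Fin 3), (∀ i j, i ≠ j → 1 ≤ dist (x i) (x j)) ∧ ∀ y : Fin N → EuclideanSpace ℝ (Fin 3), (∀ i j, i ≠ j → 1 ≤ dist (y i) (y j)) → ∑ i, ∑ j, (dist (y i) (y j))⁻¹ ^ 6 ≤ ∑ i, ∑ j, (dist (x i) (x j))⁻¹ ^ 6

/-- item stmt-AtomisticToContinuum-3270 · assembly · rank 1 · closed · moot by None · by planner
sources: BlancLewin2015
[assembly] MieLadderCrystallizes → Crystallization (n := 12; V_12 = lennardJones definitionally up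
to the cast (1/(12:ℕ) : ℝ) = 1/12). -/
@[route_item "route-AtomisticToContinuum-MieLadderVdwKissing"]
def Assembly : Prop :=
  MieLadderCrystallizes → Literature.MathematicalPhysics.StatisticalMechanics.Crystallization

end Summit.AtomisticToContinuum.Crystallization.Theses.MieLadderVdwKissing
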